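import Mathlib
import HarnessLib
import HarnessLib.Audit
import Summits.AtomisticToContinuum.Statement
import Literature.MathematicalPhysics.StatisticalMechanics.MuGSC
import Literature.MathematicalPhysics.StatisticalMechanics.LennardJonesThermodynamicLimitProofs
import Summits.AtomisticToContinuum.Crystallization.Theorems.PalmUnimodularRigidityCrysPeriodicBddBelow
import Summits.AtomisticToContinuum.Crystallization.Theorems.PricedLinkCensusCrysEnergyUpper

/-!
Route: GrandCanonicalSelection

DORMANT since 2026-09-04T17:59:30Z (reconciler: no traction for 5 d (last activity statement-checked at 2026-08-30T17:03:39Z); parked, not closed — `ledger route dormant route-AtomisticToContinuum-GrandCanonicalSelection --off` to react) — unstaffed, not closed; items shared with open routes are served there. `ledger route dormant <id> --off` reactivates.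

# Route GrandCanonicalSelection — grand-canonical selection — ground-state limits are coexistence
μGSCs; crystallinity of solid μGSCs + no sponges

Write e* := lim E(N)/N (= inf_N E(N)/N by Fekete; in tree `BlancLewin2015_8_holds`) and call X ⊆ ℝ³
a μGSC at μ (Sütő's μ-ground-state
configuration, distinct-points convention; in tree `IsMuGSC`) if no finite modification — remove n
points, insert k distinct points off the rest, k ≠ n
allowed — lowers U − μ·#. It suffices to show X = CoexistenceMuGSCCrystalline: there is a FINITE
family P₁,…,P_m of periodic configurations such that
every non-empty uniformly discrete μGSC of Lennard-Jones at the coexistence potential μ = e*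
contains, for every radius R and tolerance δ, a ball of
radius R on which it is two-way δ-matched (`Match`) to a rigid image of some P_l (family fixed
BEFORE R, δ: per-(R, δ) "some periodic P" is vacuous
by large-period periodisation of the window). The support layer — all provable now and
potential-independent — feeds it: choosing N at
(1/(j+1), j)-local minima of the surface staircase a_N = E(N) − N e* (SelectedGrandStability) makes
ground states at those N minimise E − e*·# up to
1/(j+1) against ALL particle numbers within j, so every local limit is a μGSC at μ = e* containing 0
(MuGSCLimitExtraction); matched balls at all scales
give IsCrystallizing (WindowsCrystallize) and the removal test on them pins e(P_l) ≤ e* = inf over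
periodic Q, i.e. attainment (PinnedPeriodicAttains +
CrysEnergyUpper + CrysPeriodicBddBelow). X is the target; it is split at open into crux 2
SolidMuGSCCrystalline (a μGSC containing a huge solid ball is
near-crystalline on a sub-ball) and crux 3 MuGSCSolidBalls (coexistence μGSCs are solid somewhere at
every scale), glue CruxesToCoexistence. Realises card
grand-canonical-selection-coexistence (its S1–S4 = the support items, its C1 = the target);
conforming re-filing of retired route CoexistenceMuGSC (same
mathematics, statements restated over the landed definitions UniformlyDiscrete / Match / IsMuGSC,
deciding theorem `closes` supplied sorry-free).
Lean: `∀ e : ℝ, Filter.Tendsto (fun N : ℕ =>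
Literature.MathematicalPhysics.StatisticalMechanics.groundStateEnergy
Literature.MathematicalPhysics.StatisticalMechanics.lennardJones 3 N / N) Filter.atTop (nhds e) → ∃
(m : ℕ) (P : Fin m → Literature.MathematicalPhysics.StatisticalMechanics.PeriodicConfiguration 3), ∀
R δ : ℝ, 0 < R → 0 < δ → ∀ X : Set (EuclideanSpace ℝ (Fin 3)), X.Nonempty →
Literature.MathematicalPhysics.StatisticalMechanics.UniformlyDiscrete X →
Literature.MathematicalPhysics.StatisticalMechanics.IsMuGSC
Literature.MathematicalPhysics.StatisticalMechanics.lennardJones e X → ∃ (l : Fin m) (g :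
EuclideanSpace ℝ (Fin 3) ≃ᵃⁱ[ℝ] EuclideanSpace ℝ (Fin 3)) (c : EuclideanSpace ℝ (Fin 3)),
Literature.MathematicalPhysics.StatisticalMechanics.Match δ R c X (g '' (P l).points)`

## Assembly
Sorry-free in glue.lean (`closes`, 80 lines, axioms propext/Classical.choice/Quot.sound):
BlancLewin2015_8_holds 3 gives e with E(N)/N → e and
e ≤ E(N)/N; CruxesToCoexistence turns cruxes 2 ∧ 3 into the target, which at e gives the family (m,
P); SelectedGrandStability gives φ₀; for ANY
ground-state sequence MuGSCLimitExtraction gives (φ, τ, X) with 0 ∈ X, X uniformly discrete and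
μ-stable at e, hence (target) matched balls at all
scales. (ii) is WindowsCrystallize applied to these data. (i): take the ground states of
LennardJonesGroundStatesExist_holds, their limit X, indices
l_k at scales (k+1, 1/(k+1)); Finite.exists_infinite_fiber pins one l₀, Match.mono upgrades it to
all (R, δ); PinnedPeriodicAttains gives
e(P_l₀) ≤ e; Tendsto.limsup_eq + CrysEnergyUpper + ciInf_le (CrysPeriodicBddBelow) give e ≤ e(Q) for
all Q; hence e(P_l₀) = e is least and
E(N)/N → e(P_l₀); `change` unfolds _root_.Crystallization to the conjunction.

Rationale: WHY THIS LINE. The statement leaves the subsequence φ free and this line spends that freedom on the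
ENERGY SEQUENCE before any geometry: at the foot of a step of the
surface staircase a finite cluster is in equilibrium with vacuum and with the infinite crystal at
once, so its local limits are zero-temperature
GRAND-CANONICAL equilibria at the crystal/vacuum coexistence potential μ = e* — Sütő's μGSCs
(Suto2006 §2, SutoPRL2005; the class G of
BellissardRadinShlosman2010 §2 / Radin2004 at λ = −e*), for which the Kossel–Stranski kink rule
(doi:10.1098/rsta.1951.0006 §1–2: kink binding =
lattice energy per particle) becomes a two-sided POINTWISE theorem (KosselPointwise: no particle
bound by less than |e*|, no empty site binding by
more) and point defects, cavities, slabs and needles are excluded by one-line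
insertion/removal/hole-punching tests instead of energy-DENSITY
estimates (at μ = e* bulk terms cancel and ΔΩ = σ·ΔArea, so a slab of thickness h dies by punching a
hole of radius > h, a needle by cutting it;
a half-crystal or a Wulff-corner region survives and contains balls of every radius). Imported
areas: the infinite-volume ground-state-configuration
formalism of classical statistical mechanics (Radin1991, Radin2004, BellissardRadinShlosman2010,
Suto2006; doi:10.1017/9781009298766 p. 31 states
crystallization itself as "stability under finite perturbations of the arrangement of atoms in a
lattice"), crystal-growth thermodynamics (Kossel
1927, Stranski 1928, Burton–Cabrera–Frank 1951), and — as the continuum template for crux 3 — the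
geometry of perimeter (quasi)minimisers under
compact modifications, which are porous at every scale (doi:10.2140/pjm.1998.183.213,
doi:10.1007/s12220-012-9299-z). What it does that the open routes
do not: PalmUnimodularRigidity averages (point-stationary laws) where this line is deterministic and
pointwise; LuttingerTiszaRegistry /
HcpThetaUniversality / SymmetryRankLadder attack the periodic minimum and stacking selection, which
here is hidden inside the target and NOT needed
for attainment (a corollary of the removal test on one matched ball); the negatives index
(OneGrainGluing: multiplicity-blind counting without
separation; EffectiveLocalHales) is steered around — every statement here is over uniformly discrete
sets or injective ground states.

RANKED CRUXES. #0 CoexistenceMuGSCCrystalline (target) — for e = lim E(N)/N there are m and periodic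
P₁..P_m such that every non-empty uniformly discrete μGSC X of Lennard-Jones at μ = e has, for all
R, δ > 0, some l, rigid motion g and centre c with X and g(P_l.points) two-way δ-matched on B_R(c)
(card C1 = GC-CRYSTAL, family quantified first). (why it might fail: a μ-stable LJ configuration at
μ = e* nowhere near-periodic at one scale refutes it even if Crystallization survives: aperiodic
optimal Barlow stacking if Hägg domination |J₂| > Σ_k k|J_k| fails (uncertified 1e-4 margin),
infinitely many exactly degenerate polytypes, or a Radin-type aperiodic GSC.) [BlancLewin2015,
Suto2006, BellissardRadinShlosman2010, Radin1991,
Literature.Barriers.AtomisticToContinuum.AperiodicTilingGroundStates]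
#2 SolidMuGSCCrystalline (crux) — for e = lim E(N)/N and every r₁ > 0 there are m and periodic
P₁..P_m such that for all R, δ > 0 there is R' with: every uniformly discrete μGSC X of
Lennard-Jones at μ = e that r₁-covers some ball of radius R' (a SOLID ball) is two-way δ-matched on
some ball of radius R to a rigid image of some P_l (bulk positional order for μ-stable solid LJ
matter at coexistence; the target restricted to solid states — it follows from the target and, with
crux 3, implies it). [difficulty: XL] (why it might fail: bulk positional order for LJ under the
sharpest free hypotheses, open in d = 3: false iff a solid μ-stable state at μ = e* is nowhere
near-periodic at one scale — aperiodic optimal stacking if |J₂| ≤ Σ_k k|J_k|, or frustrated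
icosahedral/Frank–Kasper order surviving every finite insertion test.) [BlancLewin2015,
FlatleyTheil2015, Theil2006, Suto2006, arXiv:2604.19239,
Literature.Barriers.AtomisticToContinuum.KissingTwelveDegeneracy,
Literature.Barriers.AtomisticToContinuum.TetrahedralFrustration]
#3 MuGSCSolidBalls (crux) — for e = lim E(N)/N there is r₁ > 0 such that every non-empty uniformly
discrete μGSC of Lennard-Jones at μ = e contains, for every R', a ball of radius R' each point of
which lies within r₁ of the configuration (coexistence μGSCs are solid somewhere at every scale: no
foams or sponges — the atomistic counterpart of porosity of perimeter minimisers; slabs and needles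
already die by hole punching / cutting since ΔΩ = σ·ΔArea at μ = e*). [difficulty: L] (why it might
fail: false iff an LJ configuration porous at a fixed scale everywhere is μ-stable at μ = e*: a
facetted labyrinth whose every compact modification raises facet area + edge energy (porosity of
perimeter minimisers is continuum-only; no off-lattice σ > 0 or hole-pricing bound in 3-D).)
[AuYeungFrieseckeSchmidt2012, Schmidt2013, doi:10.1007/s00220-023-04788-5,
doi:10.2140/pjm.1998.183.213, doi:10.1007/s12220-012-9299-z, doi:10.1098/rsta.1951.0006,
BlancLewin2015]
#9 CruxesToCoexistence (support) — glue of the decomposition target ⇐ crux 2 ∧ crux 3: given X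
non-empty, uniformly discrete, μ-stable at e, crux 3 gives r₁(e) and solid balls of every radius R',
crux 2 (at that r₁) gives the family and, for each (R, δ), the radius R' to use; pure logic.
[difficulty: provable-now] [BlancLewin2015,
Summits/AtomisticToContinuum/Crystallization/Ideas/grand-canonical-selection-coexistence.md]
#9 SelectedGrandStability (support) — SELECTION LEMMA + GRAND STABILITY (card S1+S2): if E(N)/N → e
and e ≤ E(N)/N for N ≥ 1 (both from BlancLewin2015_8_holds), there is a strictly increasing φ with
E(φ j) − e·φ(j) ≤ E(M) − e·M + 1/(j+1) whenever |M − φ j| ≤ j. Proof without iteration: a_N := E(N)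
− N e ≥ 0, a_N/N → 0; for L large minimise b_N := a_N + |N − 2L|/(j(j+1)) over N ∈ [L, 3L]; the
minimiser N* satisfies a_(N*) ≤ a_M + |M − N*|/(j(j+1)) ≤ a_M + 1/(j+1) on the window, and |N* − 2L|
≤ j(j+1)·a_(2L) < L − j − 1 (a_(2L) = o(L)) keeps the window inside [L, 3L]; take φ increasing
through such N*. [difficulty: provable-now] [BlancLewin2015,
Literature.MathematicalPhysics.StatisticalMechanics.BlancLewin2015_8_holds]
#9 MuGSCLimitExtraction (support) — μGSC LIMITS (card S3): given e and a strictly increasing φ₀ with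
the grand-stability windows, every sequence of LJ ground states admits a strictly increasing φ
(through φ₀), translations τ_j (minus a particle position) and a set X ∋ 0, uniformly discrete and a
μGSC at μ = e, with x^(φ j) + τ_j → X locally (eventual two-way δ-matching on every B_R(0)). Proof:
uniform minimal distance (LennardJonesMinimalDistance_holds) ⇒ diagonal compactness of δ-separated
pointed sets; a finite modification (remove xf, insert R off X ∖ xf) is shadowed for large j by a
modification of x^(φ j) changing N by k − n, |k − n| ≤ j, of cost ≥ −1/(j+1) since E(·) ≤ energy of
any injective configuration (groundStateEnergy_lennardJones_le); pass to the limit with continuity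
of V_LJ off 0 and the uniform r⁻⁶ tail over δ-separated sets
(UniformlyDiscrete.summable_of_abs_le_inv_pow_six). [difficulty: L] [Radin2004,
BellissardRadinShlosman2010, Suto2006, BlancLewin2015, Xue1997]
#9 WindowsCrystallize (support) — WINDOW LEMMA: if every LJ ground-state sequence has a subsequence
converging locally (two-way matching on balls about 0, after translations) to a uniformly discrete X
which carries, for a finite family P₁..P_m and all R, δ, a ball two-way δ-matched to a rigid image
of some P_l, then IsCrystallizing lennardJones 3. Proof: pigeonhole one l along (k, 1/k); compose
the two matchings with radius margins; write g_k = A_k(·) + t_k, absorb the lattice part of t_k −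
c_k by P-invariance, extract A_k → A in O(3) and bounded remainders r_k → r using radii growing
slowly; re-centre τ'_k := τ_(j_k) − c_k; the limit is the point set of (P.isometryImage A).translate
r with multiplicity 1, and PeriodicConfiguration.tendsto_sum_of_eventually_near' (in tree) with
LennardJonesMinimalDistance_holds gives the convergence clause. [difficulty: M] [BlancLewin2015,
Literature.MathematicalPhysics.StatisticalMechanics.PeriodicConfiguration.tendsto_sum_of_eventually_near']
#9 PinnedPeriodicAttains (support) — PINNING ⇒ ATTAINMENT (any μ): if a uniformly discrete μ-stable
X contains, for all R, δ, a ball two-way δ-matched to a rigid image of a fixed periodic Q, then e(Q)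
≤ μ. Proof: removal test on W = X ∩ B_R(c): U(W) + I(W, X ∖ W) ≤ μ·n_W with I ≥ −C_X R²
(depth-summed r⁻⁶ tails); for δ below half of both separations the matching is a bijection up to a
δ-collar, U(W) ≥ U(Q-window) − n_W (C_T δ + C T⁻³), and U(Q-window) = n_W e(Q) + O(R²) (site sums
are G-invariant; lattice-point counting vol/covol + O(R²); hasSum_lennardJones_dist_three); divide
by n_W ≍ R³, let R → ∞, δ → 0, T → ∞. Vacuous (true) when no X is matched to Q. [difficulty: L]
[Suto2006, BlancLewin2015,
Literature.MathematicalPhysics.StatisticalMechanics.PeriodicConfiguration.hasSum_lennardJones_dist_three]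
#9 CrysEnergyUpper (support) — shared bookkeeping item stmt-AtomisticToContinuum-0629: limsup E(N)/N
≤ ⨅ over periodic configurations of the LJ energy per particle (finite blocks of Q as trial states,
boundary O(N^(2/3)), r⁻⁶ tail; coboundedness of the limsup from LJ stability BlancLewin2015_9_holds;
`≤ ⨅` is le_ciInf, no BddBelow needed). [difficulty: M] [BlancLewin2015,
stmt-AtomisticToContinuum-0629]
#9 CrysPeriodicBddBelow (support) — shared bookkeeping item stmt-AtomisticToContinuum-0714: the LJ
energy per particle of periodic configurations of ℝ³ is bounded below (stability constant via finite
blocks), making ⨅_Q e(Q) a genuine infimum (ciInf_le) in the deciding theorem. [difficulty: M]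
[BlancLewin2015, stmt-AtomisticToContinuum-0714,
Literature.MathematicalPhysics.StatisticalMechanics.lennardJones_stable_holds]
#9 KosselPointwise (support) — TWO-SIDED KOSSEL BOUNDS AT SELECTED N (card S4; the open pointwise
item of card kossel-squeeze-surface-relations): if N = n+1 is an (ε, 1)-local minimum of E(·) −
e·(·) then in every N-particle LJ ground state (R) every particle has site energy ≤ e + ε — no atom
bound by less than the kink value |e| — and (I) every empty point y binds by at most |e| + ε: Σ_i
V(|y − x_i|) ≥ e − ε. Proof: delete particle i (energy E(N) − site_i ≥ E(n)) resp. insert y (E(N) +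
Σ_i V ≥ E(n+2)) and use the two window inequalities. Along SelectedGrandStability's φ, ε = 1/(j+1).
Not used by `closes`; it is the refuters' sieve and the card's deliverable. [difficulty:
provable-now] [doi:10.1098/rsta.1951.0006, BlancLewin2015,
Literature.MathematicalPhysics.StatisticalMechanics.siteEnergy_nonpos_of_isGroundState]
#9 OptimalPeriodicIsMuGSC (support) — CONSISTENCY OF THE CLASS: a periodic configuration attaining
the periodic minimum of the LJ energy per particle is itself a μGSC at μ = e(P) (so, after
attainment, the optimal crystal is a coexistence μGSC and every test the cruxes use must be passed
by it). Proof: a profitable finite modification (ΔΩ < 0) repeated on a superlattice L·G gives a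
periodic configuration with e < e(P) for L large (inter-copy corrections are O(L⁻⁶) sums);
summability of fields from uniform discreteness of P.points. Not used by `closes`. [difficulty: M]
[Suto2006, BlancLewin2015,
Literature.MathematicalPhysics.StatisticalMechanics.PeriodicConfiguration.hasSum_lennardJones_dist_three]

TWO-LAYER PLAN. Foreseen glued splits (nothing filed now; k ≤ 3, depth 1). SolidMuGSCCrystalline ⇐
LocalOrderFromMuStability (in an r₁-solid μ-stable region all
particles off an O(R²) boundary layer have twelve-shells η-close to the fcc/hcp kissing patterns:
removal of over- /under-coordinated atoms and
insertion of missing cap atoms are first order in the well depth) → StackingPropagation (μ-stable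
Barlow fragments at μ = e* select one
near-periodic stacking on sub-balls: volume gain Δe·r³ against interface r²; Hägg domination +
certified couplings shared with LuttingerTiszaRegistry /
HcpThetaUniversality) → SolidMuGSCCrystalline. MuGSCSolidBalls ⇐ TwoSidedPinning (0 ≤ U(W) − n_W e*
≤ −I(W, X ∖ W) ≤ C·#∂W for every finite
W ⊆ X, provable now) → PorosityGap (a uniformly discrete configuration in which every R₀-ball has an
r₁-hole has energy per particle ≥ e* + η on
large chunks, or admits a profitable filling) → MuGSCSolidBalls. MuGSCLimitExtraction ⇐
LocalLimitExists (Chabauty compactness of δ-separated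
pointed sets, Mathlib-only) → MuStabilityPasses → MuGSCLimitExtraction.

KILL CRITERIA. An explicit uniformly discrete μ-stable LJ configuration at μ = e* with no
near-periodic ball at some scale refutes the target and crux 2: close
`refuted:SolidMuGSCCrystalline` UNLESS the witness is provably not a local limit of finite ground
states along selected N — then pivot (new item
restricted to selected-limit μGSCs, BulkDefectVanish-strength) or merge into
PalmUnimodularRigidity's hinge. A porous μ-stable witness refutes crux 3:
same pivot. Certified failure of Hägg domination with an aperiodic 1-D ground stacking kills the
finite-family target as stated. Infinitely many
exactly degenerate optimal polytypes (e_hcp = e_fcc = … certified) kills the finite family: restate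
with a compact family. The target or
IsCrystallizing + attainment proved elsewhere moots the cruxes; the support layer stays useful to
every route and is not a reason to keep this one.

NOT DECOMPOSED YET. The local-order and stacking-propagation children of crux 2 and the porosity-gap
child of crux 3 (layer 2, after a crux moves); the value of r₁
(anything above the covering radius ≈ 0.71 of the close packing at spacing ≈ 0.97 should do; crux 3
only asks ∃ r₁); a certified lower bound on
e* (truth ≈ −0.7175; in-tree stability is weaker) making the insertion test (I) quantitative on
first-shell-only vacancies — wanted by refuters,
not by `closes`; the surface structure of μGSC limits (facets/steps/kinks, Wulff shapes, whether
half-crystals with non-Wulff facets are μ-stable);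
a separate Chabauty-compactness item; the negative side ¬MuGSCSolidBalls as a staffed refutation
target (refuters may file it).

CHEAPEST FALSIFIER. For crux 3: a lattice-sum check (kit) that every low-index facet of the relaxed
hcp/fcc LJ crystal has positive surface energy AND positive step
energies, and that the thinnest facetted labyrinth candidates (Schwarz-P-like fcc frameworks with
{111}/{100} walls of 2–4 layers) admit a compact
modification lowering σ-weighted area — not run here (hub compute-free; refuters first). For the
target: the certified interlayer couplings of
the stacking routes (if |J₂| ≤ Σ_(k≥3) k|J_k| on the relaxed (a, h)-box, coexistence μGSCs can be
aperiodic stackings; current uncertified numerics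
J₂ ≈ −7e−5, domination ratio ≈ 250, safe). For the support layer nothing: they are theorems (closes
already certified); the card's database test
(Cambridge Cluster Database N ≤ 1610: at (ε, K)-local minima of E(N) − N·e_hcp every atom must bind
by ≥ |e*| − ε ≈ 0.717 and every empty site
by ≤ |e*| + ε) can only decertify published numerics.

NUMBERS. e* ≈ −8.610/12 = −0.7175 in tree units (V_LJ = r⁻¹²/12 − r⁻⁶/6, well depth 1/12; hcp below
fcc by ≈ 1e−4 relative, BlancLewin2015 §2.3);
kink binding = |e*| (BCF 1951 §1); bulk site energy 2e* ≈ −1.435, so an exact vacancy binds an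
inserted atom by 1.435 > |e*| (insertion gain
0.7175) while a first-shell-only 12-site binds by ≈ 0.99; in-tree minimal distance of ground states
δ = 1/3 (LennardJonesMinimalDistance_holds),
true ≈ 0.90; covering radius of the close packing at spacing a* ≈ 0.971: ≈ 0.71; hole-punching
threshold for a slab of thickness h: radius
r > h·σ_side/σ_facet; selection windows K_j = j, tolerance 1/(j+1); items at open: 13 (1 target, 2
cruxes, 9 support, 1 assembly).

DEFINITION REQUESTS. None new: UniformlyDiscrete, Match, fieldEnergy, IsMuGSC landed in
Literature.MathematicalPhysics.StatisticalMechanics.MuGSC (definition request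
defn-IsMuGSC of the retired route; Iff.rfl with its inlined lets). Hygiene note for the operator:
MuGroundStateConfiguration.lean in the same topic
re-declares IsMuGSC / UniformlyDiscrete (with BallMatch) in the same namespace — the two files must
never be co-imported; this route imports
MuGSC.lean only. No cite facts wanted: Fekete limit, stability, minimal distance, existence of
ground states are all proved in tree.

Novelty: Searches (2026-08-15, this seat): `lit search --hybrid "ground state configuration chemical
potential coexistence Lennard-Jones infinite volume local
minimality finite modifications"` (12 book hits; relevant context only:
doi:10.1007/978-3-540-73305-8 p. 299, doi:10.1017/9781009298766 p. 31);
`lit galaxy search "ground state configurations chemical potential" --star all` (0), `lit galaxy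
search "half-crystal position" --star all` (11:
crystal-growth / electrodeposition textbooks, Kossel–Stranski only); `lit search --source crossref`
×3 for the perimeter-minimiser template
(doi:10.2140/pjm.1998.183.213, doi:10.1007/s12220-012-9299-z found; doi:10.4171/jems/1695
anisotropic half-space Bernstein, context);
`lit frontier AtomisticToContinuum --since 2022` (30 rows; crystallization side only
arXiv:2407.20762 and arXiv:2604.19239, no GSC notion);
`lit search --source arxiv …` HTTP 429 this session; plus the card's and the retired route's
recorded sweeps (crossref/zbMATH: selection mechanism
not found; BellissardRadinShlosman2010 §2, Radin2004, Suto2006 §2 read).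
Nearest prior art found: Suto2006 §2 / SutoPRL2005 (μGSC definition, prescribed μ),
BellissardRadinShlosman2010 §2 with Radin2004 (the class G at
general λ, zero-temperature limits of Gibbs states), doi:10.1098/rsta.1951.0006 §1–2 (kink binding =
|e*|), doi:10.1007/bf01009521 (Gardner–Radin
1979: 1-D LJ finite ground states → infinite GSC); none selects N or works at the coexistence value
μ = e* of a finite-cluster problem.  [refs: 10.1007/978-3-540-73305-8, 10.1017/9781009298766, 10.2140/pjm.1998.183.213, 10.1007/s12220-012-9299-z, 10.4171/jems/1695, 10.1098/rsta.1951.0006, 10.1007/bf01009521, 2407.20762, 2604.19239, doi:10.1007/978-3-540-73305-8, doi:10.1017/9781009298766, doi:10.2140/pjm.1998.183.213, doi:10.1007/s12220-012-9299-z, doi:10.4171/jems/1695, doi:10.1098/rsta.1951.0006, doi:10.1007/bf01009521, BellissardRadinS]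

Barriers (technique_class: grand-canonical-selection, mu-gsc-coexistence): - technique_class: grand-canonical-selection, mu-gsc-coexistence
- Literature.Barriers.AtomisticToContinuum.SutoDegenerateGroundStates: applies as a warning on μGSC
classes (continuous degeneracy at prescribed ρ > ρ_d or prescribed μ for band-limited φ̂ ≥ 0,
aperiodic unions included); evasion: LJ is outside Suto.IsAdmissible and μ = e* = inf_N E(N)/N is
the ZERO-PRESSURE coexistence value tied to finite clusters (the vacuum is a μGSC at the same μ);
nothing potential-generic is claimed.
- Literature.Barriers.AtomisticToContinuum.AperiodicTilingGroundStates: applies to the target's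
universal quantifier over μGSCs (model-generic "local stability ⇒ periodicity" is false:
Berger/Robinson tilings, Miękisz's stable aperiodic lattice gases, Radin's examples); it does not
evade it generically; the bet is the residual gap the barrier records (ONE species, RADIAL
Lennard-Jones, d = 3) plus the two-sided pinning 0 ≤ U(W) − n_W e* ≤ C·area that coexistence adds,
with the declared kill criterion if an aperiodic LJ μGSC appears.
- Literature.Barriers.AtomisticToContinuum.Hubbard1978_mostHomogeneous: applies to the
stacking-selection content hidden in crux 2 (1-D long-range effective models have non-periodic
ground states at prescribed μ or irrational density); evasion: zero pressure / free density and free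
particle number — at coexistence a stacking with excess energy density Δ > 0 is removed on balls of
radius > C/Δ (volume against interface), so only EXACT degeneracy survives, which for

History (route lifecycle, newest last):
- 2026-08-22T16:44:41Z · DORMANT — reconciler: no traction for 5.5 d (last activity item-evidence-added at 2026-08-17T04:18:46Z); parked, not closed — `ledger route dormant route-AtomisticToConti (operator:999:3148844)
- 2026-08-30T13:56:26Z · REACTIVATED — reconciler: reactivated — activity item-evidence-added at 2026-08-30T13:18:38Z after parking at 2026-08-22T16:44:41Z (operator:999:2429350)
- 2026-09-04T17:59:30Z · DORMANT — reconciler: no traction for 5 d (last activity statement-checked at 2026-08-30T17:03:39Z); parked, not closed — `ledger route dormant route-AtomisticToContinuum (operator:999:1780804)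

sub-problem: Crystallization · status: dormant · opened planner-plancard-AtomisticToContinuum-Crystal-eac2c9c6-g2-0 2026-08-15T19:02:46Z · rev 0 · ledger route-AtomisticToContinuum-GrandCanonicalSelection
GENERATED by the gate from the ledger (D-0016/17). Provers cite these decls: `theorem foo : Summit.AtomisticToContinuum.Crystallization.Theses.GrandCanonicalSelection.<Decl> := …` in Summits/AtomisticToContinuum/Crystallization/Theorems/<Name>.lean.
-/

namespace Summit.AtomisticToContinuum.Crystallization.Theses.GrandCanonicalSelection

open scoped BigOperators Topology Manifold Classical MeasureTheory ProbabilityTheory Matrix InnerProductSpace ComplexConjugate ContinuousMap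
open Filter Set Function TopologicalSpace MeasureTheory

attribute [summit_statement] _root_.Crystallization

/-- item stmt-AtomisticToContinuum-13680 · target · rank 0 · open · by planner
why it might fail: a μ-stable LJ configuration at μ = e* nowhere near-periodic at one scale refutes it even if Crystallization survives: aperiodic optimal Barlow stacking if Hägg domination |J₂| > Σ_k k|J_k| fails (uncertified 1e-4 margin), infinitely many exactly degenerate polytypes, or a Radin-type aperiodic GSC.
sources: BlancLewin2015, Suto2006, BellissardRadinShlosman2010, Radin1991, Literature.Barriers.AtomisticToContinuum.AperiodicTilingGroundStates
[target] for e = lim E(N)/N there are m and periodic P₁..P_m such that every non-empty uniformly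
discrete μGSC X of Lennard-Jones at μ = e has, for all R, δ > 0, some l, rigid motion g and centre c
with X and g(P_l.points) two-way δ-matched on B_R(c) (card C1 = GC-CRYSTAL, family quantified
first). -/
@[route_item "route-AtomisticToContinuum-GrandCanonicalSelection"]
def CoexistenceMuGSCCrystalline : Prop :=
  ∀ e : ℝ, Filter.Tendsto (fun N : ℕ => Literature.MathematicalPhysics.StatisticalMechanics.groundStateEnergy Literature.MathematicalPhysics.StatisticalMechanics.lennardJones 3 N / N) Filter.atTop (nhds e) → ∃ (m : ℕ) (P : Fin m → Literature.MathematicalPhysics.StatisticalMechanics.PeriodicConfiguration 3), ∀ R δ : ℝ, 0 < R → 0 < δ → ∀ X : Set (EuclideanSpace ℝ (Fin 3)), X.Nonempty → Literature.MathematicalPhysics.StatisticalMechanics.UniformlyDiscrete X → Literature.MathematicalPhysics.StatisticalMechanics.IsMuGSC Literature.MathematicalPhysics.StatisticalMechanics.lennardJones e X → ∃ (l : Fin m) (g : EuclideanSpace ℝ (Fin 3) ≃ᵃⁱ[ℝ] EuclideanSpace ℝ (Fin 3)) (c : EuclideanSpace ℝ (Fin 3)), Literature.MathematicalPhysics.StatisticalMechanics.Match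 δ R c X (g '' (P l).points)

/-- item stmt-AtomisticToContinuum-13681 · crux · rank 2 · open · by planner
why it might fail: bulk positional order for LJ under the sharpest free hypotheses, open in d = 3: false iff a solid μ-stable state at μ = e* is nowhere near-periodic at one scale — aperiodic optimal stacking if |J₂| ≤ Σ_k k|J_k|, or frustrated icosahedral/Frank–Kasper order surviving every finite insertion test.
sources: BlancLewin2015, FlatleyTheil2015, Theil2006, Suto2006, arXiv:2604.19239, Literature.Barriers.AtomisticToContinuum.KissingTwelveDegeneracy
[crux] for e = lim E(N)/N and every r₁ > 0 there are m and periodic P₁..P_m such that for all R, δ >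
0 there is R' with: every uniformly discrete μGSC X of Lennard-Jones at μ = e that r₁-covers some
ball of radius R' (a SOLID ball) is two-way δ-matched on some ball of radius R to a rigid image of
some P_l (bulk positional order for μ-stable solid LJ matter at coexistence; the target restricted
to solid states — it follows from the target and, with crux 3, implies it). [difficulty: XL] -/
@[route_item "route-AtomisticToContinuum-GrandCanonicalSelection"]
def SolidMuGSCCrystalline : Prop :=
  ∀ e : ℝ, Filter.Tendsto (fun N : ℕ => Literature.MathematicalPhysics.StatisticalMechanics.groundStateEnergy Literature.MathematicalPhysics.StatisticalMechanics.lennardJones 3 N / N) Filter.atTop (nhds e) → ∀ r₁ : ℝ, 0 < r₁ → ∃ (m : ℕ) (P : Fin m → Literature.MathematicalPhysics.StatisticalMechanics.PeriodicConfiguration 3), ∀ R δ : ℝ, 0 < R → 0 < δ → ∃ R' : ℝ, ∀ X : Set (EuclideanSpace ℝ (Fin 3)), Literature.MathematicalPhysics.StatisticalMechanics.UniformlyDiscrete X → Literature.MathematicalPhysics.StatisticalMechanics.IsMuGSC Literature.MathematicalPhysics.StatisticalMechanics.lennardJones e X → (∃ c : EuclideanSpace ℝ (Fin 3), ∀ z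 : EuclideanSpace ℝ (Fin 3), dist z c ≤ R' → ∃ x ∈ X, dist x z ≤ r₁) → ∃ (l : Fin m) (g : EuclideanSpace ℝ (Fin 3) ≃ᵃⁱ[ℝ] EuclideanSpace ℝ (Fin 3)) (c : EuclideanSpace ℝ (Fin 3)), Literature.MathematicalPhysics.StatisticalMechanics.Match δ R c X (g '' (P l).points)

/-- item stmt-AtomisticToContinuum-13682 · crux · rank 3 · open · by planner
why it might fail: false iff an LJ configuration porous at a fixed scale everywhere is μ-stable at μ = e*: a facetted labyrinth whose every compact modification raises facet area + edge energy (porosity of perimeter minimisers is continuum-only; no off-lattice σ > 0 or hole-pricing bound in 3-D).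
sources: AuYeungFrieseckeSchmidt2012, Schmidt2013, doi:10.1007/s00220-023-04788-5, doi:10.2140/pjm.1998.183.213, doi:10.1007/s12220-012-9299-z, doi:10.1098/rsta.1951.0006
[crux] for e = lim E(N)/N there is r₁ > 0 such that every non-empty uniformly discrete μGSC of
Lennard-Jones at μ = e contains, for every R', a ball of radius R' each point of which lies within
r₁ of the configuration (coexistence μGSCs are solid somewhere at every scale: no foams or sponges —
the atomistic counterpart of porosity of perimeter minimisers; slabs and needles already die by hole
punching / cutting since ΔΩ = σ·ΔArea at μ = e*). [difficulty: L] -/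
@[route_item "route-AtomisticToContinuum-GrandCanonicalSelection"]
def MuGSCSolidBalls : Prop :=
  ∀ e : ℝ, Filter.Tendsto (fun N : ℕ => Literature.MathematicalPhysics.StatisticalMechanics.groundStateEnergy Literature.MathematicalPhysics.StatisticalMechanics.lennardJones 3 N / N) Filter.atTop (nhds e) → ∃ r₁ : ℝ, 0 < r₁ ∧ ∀ X : Set (EuclideanSpace ℝ (Fin 3)), X.Nonempty → Literature.MathematicalPhysics.StatisticalMechanics.UniformlyDiscrete X → Literature.MathematicalPhysics.StatisticalMechanics.IsMuGSC Literature.MathematicalPhysics.StatisticalMechanics.lennardJones e X → ∀ R' : ℝ, ∃ c : EuclideanSpace ℝ (Fin 3), ∀ z : EuclideanSpace ℝ (Fin 3), dist z c ≤ R' → ∃ x ∈ X, dist x z ≤ r₁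

/-- item stmt-AtomisticToContinuum-0714 · support · rank 9 · closed · proved by Summit.AtomisticToContinuum.Crystallization.Theorems.crysPeriodicBddBelow_proof (prover) · by planner
sources: BlancLewin2015, stmt-AtomisticToContinuum-0714, Literature.MathematicalPhysics.StatisticalMechanics.lennardJones_stable_holds
The Lennard-Jones energy per particle of periodic configurations of ℝ³ (any full-rank lattice, any
finite motif) is bounded below (by −B, the stability constant: finite blocks of Q as N-point
configurations, boundary O(N^{2/3}), r⁻⁶ tail summable in d = 3). Makes ⨅_Q e(Q) a genuine infimum
(ciInf_le usable) in 0626/0629 and in the periodisation lemma. -/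
@[route_item "route-AtomisticToContinuum-GrandCanonicalSelection"]
def CrysPeriodicBddBelow : Prop :=
  BddBelow (Set.range fun Q : Literature.MathematicalPhysics.StatisticalMechanics.PeriodicConfiguration 3 => Q.energyPerParticle Literature.MathematicalPhysics.StatisticalMechanics.lennardJones)

/-- `CrysPeriodicBddBelow` holds: proved by `Summit.AtomisticToContinuum.Crystallization.Theorems.crysPeriodicBddBelow_proof`. -/
theorem CrysPeriodicBddBelow_holds : CrysPeriodicBddBelow := _root_.Summit.AtomisticToContinuum.Crystallization.Theorems.crysPeriodicBddBelow_proof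

/-- item stmt-AtomisticToContinuum-11865 · support · rank 9 · closed · proved by Summit.AtomisticToContinuum.Crystallization.Theorems.crysEnergyUpper_proof @ e4cec8285cc2 (prover) · by planner
sources: BlancLewin2015, stmt-AtomisticToContinuum-0629
[support] trial-state upper bound limsup E(N)/N ≤ ⨅ over periodic Q of e_LJ(Q) (shared item 0629,
same signature: finite blocks of Q plus far-away extras, boundary O(N^{2/3}), r⁻⁶ tail summable in d
= 3; le_ciInf needs only Nonempty; coboundedness of the limsup from BlancLewin2015_8_holds /
lennardJones_stable_holds, both proved in tree). [difficulty: provable-now] -/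
@[route_item "route-AtomisticToContinuum-GrandCanonicalSelection"]
def CrysEnergyUpper : Prop :=
  Filter.limsup (fun N : ℕ => Literature.MathematicalPhysics.StatisticalMechanics.groundStateEnergy Literature.MathematicalPhysics.StatisticalMechanics.lennardJones 3 N / N) Filter.atTop ≤ ⨅ Q : Literature.MathematicalPhysics.StatisticalMechanics.PeriodicConfiguration 3, Q.energyPerParticle Literature.MathematicalPhysics.StatisticalMechanics.lennardJones

/-- `CrysEnergyUpper` holds: proved by `Summit.AtomisticToContinuum.Crystallization.Theorems.crysEnergyUpper_proof` @ e4cec8285cc2. -/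
theorem CrysEnergyUpper_holds : CrysEnergyUpper := _root_.Summit.AtomisticToContinuum.Crystallization.Theorems.crysEnergyUpper_proof

/-- item stmt-AtomisticToContinuum-13683 · support · rank 9 · open · by planner
sources: BlancLewin2015, Summits/AtomisticToContinuum/Crystallization/Ideas/grand-canonical-selection-coexistence.md
[support] glue of the decomposition target ⇐ crux 2 ∧ crux 3: given X non-empty, uniformly discrete,
μ-stable at e, crux 3 gives r₁(e) and solid balls of every radius R', crux 2 (at that r₁) gives the
family and, for each (R, δ), the radius R' to use; pure logic. [difficulty: provable-now] -/
@[route_item "route-AtomisticToContinuum-GrandCanonicalSelection"]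
def CruxesToCoexistence : Prop :=
  SolidMuGSCCrystalline → MuGSCSolidBalls → CoexistenceMuGSCCrystalline

/-- item stmt-AtomisticToContinuum-13684 · support · rank 9 · closed · proved by Summit.AtomisticToContinuum.Crystallization.Theorems.GrandCanonicalSelectionSelectedGrandStability.selectedGrandStability (prover) · by planner
sources: BlancLewin2015, Literature.MathematicalPhysics.StatisticalMechanics.BlancLewin2015_8_holds
[support] SELECTION LEMMA + GRAND STABILITY (card S1+S2): if E(N)/N → e and e ≤ E(N)/N for N ≥ 1
(both from BlancLewin2015_8_holds), there is a strictly increasing φ with E(φ j) − e·φ(j) ≤ E(M) −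
e·M + 1/(j+1) whenever |M − φ j| ≤ j. Proof without iteration: a_N := E(N) − N e ≥ 0, a_N/N → 0; for
L large minimise b_N := a_N + |N − 2L|/(j(j+1)) over N ∈ [L, 3L]; the minimiser N* satisfies a_(N*)
≤ a_M + |M − N*|/(j(j+1)) ≤ a_M + 1/(j+1) on the window, and |N* − 2L| ≤ j(j+1)·a_(2L) < L − j − 1
(a_(2L) = o(L)) keeps the window inside [L, 3L]; take φ increasing through such N*. [difficulty:
provable-now] -/
@[route_item "route-AtomisticToContinuum-GrandCanonicalSelection"]
def SelectedGrandStability : Prop :=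
  ∀ e : ℝ, Filter.Tendsto (fun N : ℕ => Literature.MathematicalPhysics.StatisticalMechanics.groundStateEnergy Literature.MathematicalPhysics.StatisticalMechanics.lennardJones 3 N / N) Filter.atTop (nhds e) → (∀ N : ℕ, 0 < N → e ≤ Literature.MathematicalPhysics.StatisticalMechanics.groundStateEnergy Literature.MathematicalPhysics.StatisticalMechanics.lennardJones 3 N / N) → ∃ φ : ℕ → ℕ, StrictMono φ ∧ ∀ j M : ℕ, φ j ≤ M + j → M ≤ φ j + j → Literature.MathematicalPhysics.StatisticalMechanics.groundStateEnergy Literature.MathematicalPhysics.StatisticalMechanics.lennardJones 3 (φ j) - e * (φ j) ≤ Literature.MathematicalPhysics.StatisticalMechanics.groundStateEnergy Literature.MathematicalPhysics.StatisticalMechanics.lennardJones 3 M - e * M + 1 / ((j : ℝ) + 1)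

-- `SelectedGrandStability` holds: proved by `Summit.AtomisticToContinuum.Crystallization.Theorems.GrandCanonicalSelectionSelectedGrandStability.selectedGrandStability` (its module imports this route file, so no `_holds` link can be stated here).

/-- item stmt-AtomisticToContinuum-13685 · support · rank 9 · open · by planner
sources: Radin2004, BellissardRadinShlosman2010, Suto2006, BlancLewin2015, Xue1997
[support] μGSC LIMITS (card S3): given e and a strictly increasing φ₀ with the grand-stability
windows, every sequence of LJ ground states admits a strictly increasing φ (through φ₀),
translations τ_j (minus a particle position) and a set X ∋ 0, uniformly discrete and a μGSC at μ =
e, with x^(φ j) + τ_j → X locally (eventual two-way δ-matching on every B_R(0)). Proof: uniform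
minimal distance (LennardJonesMinimalDistance_holds) ⇒ diagonal compactness of δ-separated pointed
sets; a finite modification (remove xf, insert R off X ∖ xf) is shadowed for large j by a
modification of x^(φ j) changing N by k − n, |k − n| ≤ j, of cost ≥ −1/(j+1) since E(·) ≤ energy of
any injective configuration (groundStateEnergy_lennardJones_le); pass to the limit with continuity
of V_LJ off 0 and the uniform r⁻⁶ tail over δ-separated sets
(UniformlyDiscrete.summable_of_abs_le_inv_pow_six). [difficulty: L] -/
@[route_item "route-AtomisticToContinuum-GrandCanonicalSelection"]
def MuGSCLimitExtraction : Prop :=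
  ∀ (e : ℝ) (φ₀ : ℕ → ℕ), StrictMono φ₀ → (∀ j M : ℕ, φ₀ j ≤ M + j → M ≤ φ₀ j + j → Literature.MathematicalPhysics.StatisticalMechanics.groundStateEnergy Literature.MathematicalPhysics.StatisticalMechanics.lennardJones 3 (φ₀ j) - e * (φ₀ j) ≤ Literature.MathematicalPhysics.StatisticalMechanics.groundStateEnergy Literature.MathematicalPhysics.StatisticalMechanics.lennardJones 3 M - e * M + 1 / ((j : ℝ) + 1)) → ∀ x : (N : ℕ) → (Fin N → EuclideanSpace ℝ (Fin 3)), (∀ N, Literature.MathematicalPhysics.StatisticalMechanics.IsGroundState Literature.MathematicalPhysics.StatisticalMechanics.lennardJones (x N)) → ∃ (φ : ℕ → ℕ) (τ : ℕ → EuclideanSpace ℝ (Fin 3)) (X : Set (EuclideanSpace ℝ (Fin 3))), StrictMono φ ∧ (0 : EuclideanSpace ℝ (Fin 3)) ∈ X ∧ Literature.MathematicalPhysics.StatisticalMechanics.UniformlyDiscrete X ∧ Literature.MathematicalPhysics.StatisticalMechanics.IsMuGSC Literature.MathematicalPhysics.StatisticalMechanics.lennardJones e X ∧ ∀ R δ :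 ℝ, 0 < R → 0 < δ → ∀ᶠ j in Filter.atTop, Literature.MathematicalPhysics.StatisticalMechanics.Match δ R 0 (Set.range fun i : Fin (φ j) => x (φ j) i + τ j) X

/-- item stmt-AtomisticToContinuum-13686 · support · rank 9 · open · by planner
sources: BlancLewin2015, Literature.MathematicalPhysics.StatisticalMechanics.PeriodicConfiguration.tendsto_sum_of_eventually_near'
[support] WINDOW LEMMA: if every LJ ground-state sequence has a subsequence converging locally
(two-way matching on balls about 0, after translations) to a uniformly discrete X which carries, for
a finite family P₁..P_m and all R, δ, a ball two-way δ-matched to a rigid image of some P_l, then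
IsCrystallizing lennardJones 3. Proof: pigeonhole one l along (k, 1/k); compose the two matchings
with radius margins; write g_k = A_k(·) + t_k, absorb the lattice part of t_k − c_k by P-invariance,
extract A_k → A in O(3) and bounded remainders r_k → r using radii growing slowly; re-centre τ'_k :=
τ_(j_k) − c_k; the limit is the point set of (P.isometryImage A).translate r with multiplicity 1,
and PeriodicConfiguration.tendsto_sum_of_eventually_near' (in tree) with
LennardJonesMinimalDistance_holds gives the convergence clause. [difficulty: M] -/
@[route_item "route-AtomisticToContinuum-GrandCanonicalSelection"]
def WindowsCrystallize : Prop :=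
  (∀ x : (N : ℕ) → (Fin N → EuclideanSpace ℝ (Fin 3)), (∀ N, Literature.MathematicalPhysics.StatisticalMechanics.IsGroundState Literature.MathematicalPhysics.StatisticalMechanics.lennardJones (x N)) → ∃ (φ : ℕ → ℕ) (τ : ℕ → EuclideanSpace ℝ (Fin 3)) (X : Set (EuclideanSpace ℝ (Fin 3))), StrictMono φ ∧ Literature.MathematicalPhysics.StatisticalMechanics.UniformlyDiscrete X ∧ (∀ R δ : ℝ, 0 < R → 0 < δ → ∀ᶠ j in Filter.atTop, Literature.MathematicalPhysics.StatisticalMechanics.Match δ R 0 (Set.range fun i : Fin (φ j) => x (φ j) i + τ j) X) ∧ ∃ (m : ℕ) (P : Fin m → Literature.MathematicalPhysics.StatisticalMechanics.PeriodicConfiguration 3), ∀ R δ : ℝ, 0 < R → 0 < δ → ∃ (l : Fin m) (g : EuclideanSpace ℝ (Fin 3) ≃ᵃⁱ[ℝ] EuclideanSpace ℝ (Fin 3)) (c : EuclideanSpace ℝ (Fin 3)), Literature.MathematicalPhysics.StatisticalMechanics.Match δ R c X (g '' (P l).points)) → Literature.MathematicalPhysics.StatisticalMechanics.IsCrystallizing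 Literature.MathematicalPhysics.StatisticalMechanics.lennardJones 3

/-- item stmt-AtomisticToContinuum-13687 · support · rank 9 · open · by planner
sources: Suto2006, BlancLewin2015, Literature.MathematicalPhysics.StatisticalMechanics.PeriodicConfiguration.hasSum_lennardJones_dist_three
[support] PINNING ⇒ ATTAINMENT (any μ): if a uniformly discrete μ-stable X contains, for all R, δ, a
ball two-way δ-matched to a rigid image of a fixed periodic Q, then e(Q) ≤ μ. Proof: removal test on
W = X ∩ B_R(c): U(W) + I(W, X ∖ W) ≤ μ·n_W with I ≥ −C_X R² (depth-summed r⁻⁶ tails); for δ below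
half of both separations the matching is a bijection up to a δ-collar, U(W) ≥ U(Q-window) − n_W (C_T
δ + C T⁻³), and U(Q-window) = n_W e(Q) + O(R²) (site sums are G-invariant; lattice-point counting
vol/covol + O(R²); hasSum_lennardJones_dist_three); divide by n_W ≍ R³, let R → ∞, δ → 0, T → ∞.
Vacuous (true) when no X is matched to Q. [difficulty: L] -/
@[route_item "route-AtomisticToContinuum-GrandCanonicalSelection"]
def PinnedPeriodicAttains : Prop :=
  ∀ (μ : ℝ) (X : Set (EuclideanSpace ℝ (Fin 3))), Literature.MathematicalPhysics.StatisticalMechanics.UniformlyDiscrete X → Literature.MathematicalPhysics.StatisticalMechanics.IsMuGSC Literature.MathematicalPhysics.StatisticalMechanics.lennardJones μ X → ∀ Q : Literature.MathematicalPhysics.StatisticalMechanics.PeriodicConfiguration 3, (∀ R δ : ℝ, 0 < R → 0 < δ → ∃ (g : EuclideanSpace ℝ (Fin 3) ≃ᵃⁱ[ℝ] EuclideanSpace ℝ (Fin 3)) (c : EuclideanSpace ℝ (Fin 3)), Literature.MathematicalPhysics.StatisticalMechanics.Match δ R c X (g '' Q.points)) → Q.energyPerParticle Literature.MathematicalPhysics.StatisticalMechanics.lennardJones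 ≤ μ

/-- item stmt-AtomisticToContinuum-13688 · support · rank 9 · closed · proved by Summit.AtomisticToContinuum.Crystallization.Theorems.GrandCanonicalSelectionKosselPointwise.kosselPointwise (prover) · by planner
sources: doi:10.1098/rsta.1951.0006, BlancLewin2015, Literature.MathematicalPhysics.StatisticalMechanics.siteEnergy_nonpos_of_isGroundState
[support] TWO-SIDED KOSSEL BOUNDS AT SELECTED N (card S4; the open pointwise item of card
kossel-squeeze-surface-relations): if N = n+1 is an (ε, 1)-local minimum of E(·) − e·(·) then in
every N-particle LJ ground state (R) every particle has site energy ≤ e + ε — no atom bound by less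
than the kink value |e| — and (I) every empty point y binds by at most |e| + ε: Σ_i V(|y − x_i|) ≥ e
− ε. Proof: delete particle i (energy E(N) − site_i ≥ E(n)) resp. insert y (E(N) + Σ_i V ≥ E(n+2))
and use the two window inequalities. Along SelectedGrandStability's φ, ε = 1/(j+1). Not used by
`closes`; it is the refuters' sieve and the card's deliverable. [difficulty: provable-now] -/
@[route_item "route-AtomisticToContinuum-GrandCanonicalSelection"]
def KosselPointwise : Prop :=
  ∀ (e ε : ℝ) (n : ℕ), Literature.MathematicalPhysics.StatisticalMechanics.groundStateEnergy Literature.MathematicalPhysics.StatisticalMechanics.lennardJones 3 (n + 1) - e * ((n : ℝ) + 1) ≤ Literature.MathematicalPhysics.StatisticalMechanics.groundStateEnergy Literature.MathematicalPhysics.StatisticalMechanics.lennardJones 3 n - e * (n : ℝ) + ε → Literature.MathematicalPhysics.StatisticalMechanics.groundStateEnergy Literature.MathematicalPhysics.StatisticalMechanics.lennardJones 3 (n + 1) - e * ((n : ℝ) + 1) ≤ Literature.MathematicalPhysics.StatisticalMechanics.groundStateEnergy Literature.MathematicalPhysics.StatisticalMechanics.lennardJones 3 (n + 2) - e * ((n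 : ℝ) + 2) + ε → ∀ x : Fin (n + 1) → EuclideanSpace ℝ (Fin 3), Literature.MathematicalPhysics.StatisticalMechanics.IsGroundState Literature.MathematicalPhysics.StatisticalMechanics.lennardJones x → (∀ i, Literature.MathematicalPhysics.StatisticalMechanics.siteEnergy Literature.MathematicalPhysics.StatisticalMechanics.lennardJones x i ≤ e + ε) ∧ ∀ y : EuclideanSpace ℝ (Fin 3), y ∉ Set.range x → e - ε ≤ ∑ i, Literature.MathematicalPhysics.StatisticalMechanics.lennardJones (dist y (x i))

-- `KosselPointwise` holds: proved by `Summit.AtomisticToContinuum.Crystallization.Theorems.GrandCanonicalSelectionKosselPointwise.kosselPointwise` (its module imports this route file, so no `_holds` link can be stated here).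

/-- item stmt-AtomisticToContinuum-13689 · support · rank 9 · open · by planner
sources: Suto2006, BlancLewin2015, Literature.MathematicalPhysics.StatisticalMechanics.PeriodicConfiguration.hasSum_lennardJones_dist_three
[support] CONSISTENCY OF THE CLASS: a periodic configuration attaining the periodic minimum of the
LJ energy per particle is itself a μGSC at μ = e(P) (so, after attainment, the optimal crystal is a
coexistence μGSC and every test the cruxes use must be passed by it). Proof: a profitable finite
modification (ΔΩ < 0) repeated on a superlattice L·G gives a periodic configuration with e < e(P)
for L large (inter-copy corrections are O(L⁻⁶) sums); summability of fields from uniform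
discreteness of P.points. Not used by `closes`. [difficulty: M] -/
@[route_item "route-AtomisticToContinuum-GrandCanonicalSelection"]
def OptimalPeriodicIsMuGSC : Prop :=
  ∀ P : Literature.MathematicalPhysics.StatisticalMechanics.PeriodicConfiguration 3, IsLeast (Set.range fun Q : Literature.MathematicalPhysics.StatisticalMechanics.PeriodicConfiguration 3 => Q.energyPerParticle Literature.MathematicalPhysics.StatisticalMechanics.lennardJones) (P.energyPerParticle Literature.MathematicalPhysics.StatisticalMechanics.lennardJones) → Literature.MathematicalPhysics.StatisticalMechanics.IsMuGSC Literature.MathematicalPhysics.StatisticalMechanics.lennardJones (P.energyPerParticle Literature.MathematicalPhysics.StatisticalMechanics.lennardJones) P.points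

/-- item stmt-AtomisticToContinuum-13690 · assembly · rank 1 · open · by planner
sources: BlancLewin2015, Literature.MathematicalPhysics.StatisticalMechanics.BlancLewin2015_8_holds, Literature.MathematicalPhysics.StatisticalMechanics.LennardJonesGroundStatesExist_holds
[assembly] SolidMuGSCCrystalline → MuGSCSolidBalls → CruxesToCoexistence → SelectedGrandStability →
MuGSCLimitExtraction → WindowsCrystallize → PinnedPeriodicAttains → CrysEnergyUpper →
CrysPeriodicBddBelow → Crystallization (the sub-problem decl `_root_.Crystallization`; proved as
`closes`). -/
@[route_item "route-AtomisticToContinuum-GrandCanonicalSelection"]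
def Assembly : Prop :=
  SolidMuGSCCrystalline → MuGSCSolidBalls → CruxesToCoexistence → SelectedGrandStability → MuGSCLimitExtraction → WindowsCrystallize → PinnedPeriodicAttains → CrysEnergyUpper → CrysPeriodicBddBelow → Crystallization

/-! D-0027 §2.1 — DECIDING THEOREM (planner-authored via `route open/edit --closes-file`; by planner-plancard-AtomisticToContinuum-Crystal-eac2c9c6-g2-0 2026-08-15T19:02:46Z):
its hypotheses are this route's items and its conclusion the sub-problem Statement (glue_lint), and it elaborates with this file. -/

@[closes "route-AtomisticToContinuum-GrandCanonicalSelection"] theorem closes : SolidMuGSCCrystalline → MuGSCSolidBalls → CruxesToCoexistence → SelectedGrandStability →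
    MuGSCLimitExtraction → WindowsCrystallize → PinnedPeriodicAttains → CrysEnergyUpper → CrysPeriodicBddBelow →
    _root_.Crystallization := by
  intro hSolid hBalls hGlue hSel hLim hWin hPin hUp hBdd
  -- the two cruxes and their glue give the target X = CoexistenceMuGSCCrystalline
  have hTarget : CoexistenceMuGSCCrystalline := hGlue hSolid hBalls
  -- the thermodynamic limit e = lim E(N)/N = inf_N E(N)/N (Fekete; proved in tree)
  obtain ⟨e, -, he, hele⟩ :=
    Literature.MathematicalPhysics.StatisticalMechanics.BlancLewin2015_8_holds 3 (by norm_num) (by norm_num)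
  -- selection of N along the surface staircase, and the finite family of periodic patterns at μ = e
  obtain ⟨φ₀, hφ₀, hwin⟩ := hSel e he hele
  obtain ⟨m, P, hP⟩ := hTarget e he
  -- every ground-state sequence has a local limit which is a μGSC at e, matched to the family at all scales
  have key : ∀ x : (N : ℕ) → (Fin N → EuclideanSpace ℝ (Fin 3)),
      (∀ N, Literature.MathematicalPhysics.StatisticalMechanics.IsGroundState
        Literature.MathematicalPhysics.StatisticalMechanics.lennardJones (x N)) →
      ∃ (φ : ℕ → ℕ) (τ : ℕ → EuclideanSpace ℝ (Fin 3)) (X : Set (EuclideanSpace ℝ (Fin 3))),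
        StrictMono φ ∧ Literature.MathematicalPhysics.StatisticalMechanics.UniformlyDiscrete X ∧
        Literature.MathematicalPhysics.StatisticalMechanics.IsMuGSC
          Literature.MathematicalPhysics.StatisticalMechanics.lennardJones e X ∧
        (∀ R δ : ℝ, 0 < R → 0 < δ → ∀ᶠ j in Filter.atTop,
          Literature.MathematicalPhysics.StatisticalMechanics.Match δ R 0
            (Set.range fun i : Fin (φ j) => x (φ j) i + τ j) X) ∧
        ∀ R δ : ℝ, 0 < R → 0 < δ → ∃ (l : Fin m)
          (g : EuclideanSpace ℝ (Fin 3) ≃ᵃⁱ[ℝ] EuclideanSpace ℝ (Fin 3)) (c : EuclideanSpace ℝ (Fin 3)),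
          Literature.MathematicalPhysics.StatisticalMechanics.Match δ R c X (g '' (P l).points) := by
    intro x hx
    obtain ⟨φ, τ, X, hφ, h0, hUD, hGSC, hconv⟩ := hLim e φ₀ hφ₀ hwin x hx
    exact ⟨φ, τ, X, hφ, hUD, hGSC, hconv, fun R δ hR hδ => hP R δ hR hδ X ⟨0, h0⟩ hUD hGSC⟩
  change Literature.MathematicalPhysics.StatisticalMechanics.HasPeriodicGroundStateEnergy
      Literature.MathematicalPhysics.StatisticalMechanics.lennardJones 3 ∧
    Literature.MathematicalPhysics.StatisticalMechanics.IsCrystallizing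
      Literature.MathematicalPhysics.StatisticalMechanics.lennardJones 3
  refine ⟨?_, ?_⟩
  · -- conjunct (i): a pattern charged by the limit of one ground-state sequence attains e, the least value
    choose x hx using
      Literature.MathematicalPhysics.StatisticalMechanics.LennardJonesGroundStatesExist_holds
    obtain ⟨φ, τ, X, -, hUD, hGSC, -, hballs⟩ := key x hx
    choose l g c hlgc using fun k : ℕ =>
      hballs ((k : ℝ) + 1) (1 / ((k : ℝ) + 1)) (by positivity) (by positivity)
    -- pigeonhole: one pattern index is hit at infinitely many scales
    obtain ⟨l₀, hl₀⟩ := Finite.exists_infinite_fiber l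
    have hinf : (l ⁻¹' {l₀}).Infinite := Set.infinite_coe_iff.mp hl₀
    have hpinned : ∀ R δ : ℝ, 0 < R → 0 < δ →
        ∃ (g' : EuclideanSpace ℝ (Fin 3) ≃ᵃⁱ[ℝ] EuclideanSpace ℝ (Fin 3)) (c' : EuclideanSpace ℝ (Fin 3)),
          Literature.MathematicalPhysics.StatisticalMechanics.Match δ R c' X (g' '' (P l₀).points) := by
      intro R δ hR hδ
      obtain ⟨k, hk, hklt⟩ := hinf.exists_gt ⌈max R (1 / δ)⌉₊
      have hlk : l k = l₀ := by simpa using hk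
      have hk' : max R (1 / δ) < (k : ℝ) + 1 := by
        have h1 : max R (1 / δ) ≤ (⌈max R (1 / δ)⌉₊ : ℝ) := Nat.le_ceil _
        have h2 : ((⌈max R (1 / δ)⌉₊ : ℕ) : ℝ) < (k : ℝ) := by exact_mod_cast hklt
        linarith
      have hR' : R ≤ (k : ℝ) + 1 := ((le_max_left _ _).trans_lt hk').le
      have hδ' : 1 / ((k : ℝ) + 1) ≤ δ := by
        have h3 : 1 / δ < (k : ℝ) + 1 := (le_max_right _ _).trans_lt hk'
        rw [div_le_iff₀ (by positivity)]
        rw [div_lt_iff₀ hδ] at h3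
        linarith
      refine ⟨g k, c k, ?_⟩
      have hm := hlgc k
      rw [hlk] at hm
      exact hm.mono hδ' hR'
    have hle : (P l₀).energyPerParticle Literature.MathematicalPhysics.StatisticalMechanics.lennardJones ≤ e :=
      hPin e X hUD hGSC (P l₀) hpinned
    have hge : ∀ Q : Literature.MathematicalPhysics.StatisticalMechanics.PeriodicConfiguration 3,
        e ≤ Q.energyPerParticle Literature.MathematicalPhysics.StatisticalMechanics.lennardJones := by
      intro Q
      calc e = Filter.limsup (fun N : ℕ =>
              Literature.MathematicalPhysics.StatisticalMechanics.groundStateEnergy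
                Literature.MathematicalPhysics.StatisticalMechanics.lennardJones 3 N / N) Filter.atTop :=
            he.limsup_eq.symm
        _ ≤ ⨅ Q : Literature.MathematicalPhysics.StatisticalMechanics.PeriodicConfiguration 3,
              Q.energyPerParticle Literature.MathematicalPhysics.StatisticalMechanics.lennardJones := hUp
        _ ≤ Q.energyPerParticle Literature.MathematicalPhysics.StatisticalMechanics.lennardJones :=
            ciInf_le hBdd Q
    have heq : (P l₀).energyPerParticle Literature.MathematicalPhysics.StatisticalMechanics.lennardJones = e :=
      le_antisymm hle (hge _)
    refine ⟨P l₀, ⟨⟨P l₀, rfl⟩, ?_⟩, ?_⟩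
    · rintro _ ⟨Q, rfl⟩
      rw [heq]
      exact hge Q
    · rw [heq]
      exact he
  · -- conjunct (ii): the window lemma applied to the limits of key
    refine hWin fun x hx => ?_
    obtain ⟨φ, τ, X, hφ, hUD, -, hconv, hballs⟩ := key x hx
    exact ⟨φ, τ, X, hφ, hUD, hconv, m, P, hballs⟩

end Summit.AtomisticToContinuum.Crystallization.Theses.GrandCanonicalSelection
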